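import Mathlib
import HarnessLib
import Literature.Analysis.FluidPDE.LerayHopfMild
import Summits.NavierStokesRegularity.NavierStokesRegularity.Theorems.QuarterLogPincerTypeIQuantSubcubicExpZoomPairing
import Summits.NavierStokesRegularity.NavierStokesRegularity.Theorems.QuarterLogPincerTypeIQuantSubcubicExpZoomTrace

/-!
# Crux `QuarterLogPincer.TypeIQuantSubcubicExp` (stmt-NavierStokesRegularity-24077), line `thin_cascade`:
  clause (5) of `ThinObject` — the weak trace of the zoom limit is attained as `t ↑ 0`

Helper file (`--supports stmt-NavierStokesRegularity-24077 --as helper`, lead prover ns-tc-p1 g3) toward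
the registered stub `stub_thinObjectExtraction` (S2, skeleton v5), trace block.

* `abs_pairing_zoom_sub_le` — for one cheap-cascade frame and a `C²` field `θ` vanishing off
  `B(0, R)`, the zoom `v = ρ u(T + ρ²·, x₀ + ρ·)` has
  `|⟪v(0), θ⟫ - ⟪v(s), θ⟫| ≤ K(θ, M) (-s)^{1/4}` for `s ∈ (-1, 0)` once `e^{2K} ≥ R² + 1`
  (the previous file's `abs_pairing_sub_le_of_classical` for the unit rescale on `[0, T/ρ²]`, fed by
  the `A` and `D` clauses of `stub_uniformScaledEnergy` transported to zoom variables);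
* `tendsto_pairing_zoomLimit_of_cheapCascades` — hence, for the pointwise limit `W` of the zooms on
  the open past and the weak limit `g` of their final slices (the trace of
  `exists_traceLimit_of_cheapCascades`), `∫⟪W(t), θ⟫ → ∫⟪g, θ⟫` as `t ↑ 0` for every smooth
  compactly supported `θ`: clause (5) of `ThinObject`.

HONEST FRAMING: bookkeeping toward one registered stub of an open crux; nothing about Navier–Stokes
regularity is proved; no summit statement is proved by this file.
-/

noncomputable section

-- the summit-side namespace `Summit.NavierStokesRegularity.NavierStokesRegularity.…` (single-conjunct summit,
-- D-0017) repeats a component by design; the dupNamespace linter would flag every declaration.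
set_option linter.dupNamespace false

namespace Summit.NavierStokesRegularity.NavierStokesRegularity.Theorems.ThinCascade

open MeasureTheory Set Function Metric Filter Topology
open scoped ENNReal NNReal InnerProductSpace RealInnerProductSpace Laplacian ContDiff
open Literature.Analysis Literature.Analysis.FluidPDE
open Summit.NavierStokesRegularity.NavierStokesRegularity.Theorems
open Summit.NavierStokesRegularity.NavierStokesRegularity.Cruxes.TypeIQuantSubcubicExp.ThinCascade

/-- **Time modulus of the pairings of one zoom.**  For a Tao-frame solution with the virtual Type-I
bound, backward life `e^{2K} ρ² ≤ T`, `e^{2K} ≥ R² + 1`, and a `C²` field `θ` vanishing off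
`B(0, R)` (`R ≥ 1`) with `‖Dθ‖ ≤ C₁`, `‖Δθ‖ ≤ C₂`, `|div θ| ≤ C₃`: the zoom
`v = ρ u(T + ρ²·, x₀ + ρ·)` satisfies, for `s ∈ (-1, 0)`,
`|⟪v(0), θ⟫ - ⟪v(s), θ⟫| ≤ (C₁ C'R + C₂ (|B| + C'R) + C₃ (C'R² + |B|)) (-s)^{1/4}`, `C' = max C 0`,
where `C` is the constant of the uniform scaled energy clause `hC`. [folklore] -/
theorem abs_pairing_zoom_sub_le {M C T τ ρ R C₁ C₂ C₃ : ℝ} {K : ℕ} (x₀ : EuclideanSpace ℝ (Fin 3))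
    {u : ℝ → EuclideanSpace ℝ (Fin 3) → EuclideanSpace ℝ (Fin 3)}
    {p : ℝ → EuclideanSpace ℝ (Fin 3) → ℝ}
    (hC : ∀ (T τ : ℝ) (u : ℝ → EuclideanSpace ℝ (Fin 3) → EuclideanSpace ℝ (Fin 3))
      (p : ℝ → EuclideanSpace ℝ (Fin 3) → ℝ), TaoFrame T u p → 0 < τ →
      (∀ t ∈ Icc 0 T, ∀ x : EuclideanSpace ℝ (Fin 3), ‖u t x‖ ≤ M * (T + τ - t) ^ (-(1 / 2 : ℝ))) →
      ∀ (x : EuclideanSpace ℝ (Fin 3)) (r : ℝ), 0 < r → r ^ 2 ≤ T →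
        (∀ t ∈ Icc (T - r ^ 2) T,
          ∫⁻ y in ball x r, ENNReal.ofReal (‖u t y‖ ^ 2) ≤ ENNReal.ofReal (C * r)) ∧
        (∫⁻ t in Icc (T - r ^ 2) T, ∫⁻ y in ball x r,
          ENNReal.ofReal (‖fderiv ℝ (u t) y‖ ^ 2) ≤ ENNReal.ofReal (C * r)) ∧
        (∫⁻ t in Icc (T - r ^ 2) T, ∫⁻ y in ball x r,
          ENNReal.ofReal (|p t y - ⨍ z in ball x r, p t z| ^ (3 / 2 : ℝ)) ≤ ENNReal.ofReal (C * r ^ 2)))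
    (hfr : TaoFrame T u p) (hτ : 0 < τ) (hρ : 0 < ρ) (hlife : Real.exp (2 * K) * ρ ^ 2 ≤ T)
    (hrate : ∀ t ∈ Icc 0 T, ∀ x : EuclideanSpace ℝ (Fin 3), ‖u t x‖ ≤ M * (T + τ - t) ^ (-(1 / 2 : ℝ)))
    {θ : EuclideanSpace ℝ (Fin 3) → EuclideanSpace ℝ (Fin 3)} (hθ : ContDiff ℝ 2 θ) (hR : 1 ≤ R)
    (hθR : ∀ y, y ∉ ball (0 : EuclideanSpace ℝ (Fin 3)) R → θ y = 0)
    (hC₁ : ∀ y, ‖fderiv ℝ θ y‖ ≤ C₁) (hC₂ : ∀ y, ‖(Δ θ) y‖ ≤ C₂)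
    (hC₃ : ∀ y, ‖VectorCalculus.divergence θ y‖ ≤ C₃)
    (hKR : R ^ 2 + 1 ≤ Real.exp (2 * K)) {s : ℝ} (hs : s ∈ Ioo (-1 : ℝ) 0) :
    |(∫ y, ⟪(ρ • stPull (ρ ^ 2) ρ T x₀ u) 0 y, θ y⟫) -
        ∫ y, ⟪(ρ • stPull (ρ ^ 2) ρ T x₀ u) s y, θ y⟫| ≤
      (C₁ * (max C 0 * R) + C₂ * ((volume (ball (0 : EuclideanSpace ℝ (Fin 3)) R)).toReal + max C 0 * R) +
        C₃ * (max C 0 * R ^ 2 + (volume (ball (0 : EuclideanSpace ℝ (Fin 3)) R)).toReal)) *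
        Real.sqrt (Real.sqrt (-s)) := by
  have hρ2 : 0 < ρ ^ 2 := by positivity
  have hR0 : 0 < R := by linarith
  have hCC' : C ≤ max C 0 := le_max_left _ _
  have hC'0 : 0 ≤ max C 0 := le_max_right _ _
  have hexp1 : (1 : ℝ) ≤ Real.exp (2 * K) := Real.one_le_exp (by positivity)
  have hρT : ρ ^ 2 * (R ^ 2 + 1) ≤ T := le_trans (by nlinarith) hlife
  have hT0 : 0 < T := lt_of_lt_of_le (by positivity) hρT
  -- the unit rescale `w'(σ, y) = ρ u(ρ²σ, x₀ + ρy)` on `[0, T/ρ²]`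
  have hcl' : IsClassicalNSSolutionOn (Icc 0 (T / ρ ^ 2)) 1 0 (ρ • stPull (ρ ^ 2) ρ 0 x₀ u)
      (ρ ^ 2 • stPull (ρ ^ 2) ρ 0 x₀ p) := rescale_classical hρ x₀ hfr.1
  have hT' : 1 ≤ T / ρ ^ 2 := by
    rw [le_div_iff₀ hρ2]; nlinarith
  -- the zoom is the time translate of the unit rescale
  have hvw : ∀ r y, (ρ • stPull (ρ ^ 2) ρ T x₀ u) r y =
      (ρ • stPull (ρ ^ 2) ρ 0 x₀ u) (T / ρ ^ 2 + r) y := by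
    intro r y
    rw [smul_stPull_apply, smul_stPull_apply]
    congr 2
    field_simp
    ring
  simp only [hvw, add_zero]
  have ht : T / ρ ^ 2 + s ∈ Ico (T / ρ ^ 2 - 1) (T / ρ ^ 2) := ⟨by linarith [hs.1], by linarith [hs.2]⟩
  -- clause `A` transported: unit-ball energies of the rescale on `[T/ρ² - 1, T/ρ²]`
  have hE : ∀ σ ∈ Icc (T / ρ ^ 2 - 1) (T / ρ ^ 2),
      ∫⁻ y in ball (0 : EuclideanSpace ℝ (Fin 3)) R, ‖(ρ • stPull (ρ ^ 2) ρ 0 x₀ u) σ y‖ₑ ^ 2 ≤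
        ENNReal.ofReal (max C 0 * R) := by
    intro σ hσ
    obtain ⟨tstar, htstar⟩ : ∃ tstar : ℝ, tstar = ρ ^ 2 * σ := ⟨_, rfl⟩
    have hσ1 : T - ρ ^ 2 ≤ tstar := by
      rw [htstar]; have := hσ.1; rw [sub_le_iff_le_add, div_le_iff₀ hρ2] at this; nlinarith
    have htle : tstar ≤ T := by
      rw [htstar]; have := hσ.2; rw [le_div_iff₀ hρ2] at this; nlinarith
    have hRt : (ρ * R) ^ 2 ≤ tstar := by nlinarith
    have htpos : 0 < tstar := lt_of_lt_of_le (by positivity) hRt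
    have hfr' : TaoFrame tstar u p := frame_restrict hfr htpos htle
    have hrate' := typeI_restrict hrate htle
    have hτ' : 0 < T - tstar + τ := by linarith
    obtain ⟨hA, -, -⟩ := hC tstar (T - tstar + τ) u p hfr' hτ' hrate' x₀ (ρ * R) (by positivity) hRt
    have h1 := hA tstar ⟨by nlinarith, le_rfl⟩
    have h2 : ∫⁻ x in ball x₀ (ρ * R), ‖u tstar x‖ₑ ^ 2 ≤ ENNReal.ofReal (C * (ρ * R)) := by
      refine le_trans (le_of_eq (lintegral_congr fun x => ?_)) h1
      rw [← ofReal_norm, ENNReal.ofReal_pow (norm_nonneg _)]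
    rw [lintegral_sq_ball_zoom hρ 0 x₀ u σ 0 R, smul_zero, add_zero, zero_add, ← htstar]
    calc (ENNReal.ofReal ρ)⁻¹ * ∫⁻ x in ball x₀ (ρ * R), ‖u tstar x‖ₑ ^ 2
        ≤ (ENNReal.ofReal ρ)⁻¹ * ENNReal.ofReal (C * (ρ * R)) := mul_le_mul' le_rfl h2
      _ = ENNReal.ofReal (C * R) := by
          rw [← ENNReal.ofReal_inv_of_pos hρ, ← ENNReal.ofReal_mul (by positivity)]
          congr 1
          field_simp
      _ ≤ ENNReal.ofReal (max C 0 * R) := ENNReal.ofReal_le_ofReal (by nlinarith)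
  -- clause `D` transported: the mean-oscillation budget of the rescaled pressure on `[T/ρ² - 1, T/ρ²]`
  have hD : ∫⁻ σ in Icc (T / ρ ^ 2 - 1) (T / ρ ^ 2), ∫⁻ y in ball (0 : EuclideanSpace ℝ (Fin 3)) R,
      ‖(ρ ^ 2 • stPull (ρ ^ 2) ρ 0 x₀ p) σ y -
          ⨍ z in ball (0 : EuclideanSpace ℝ (Fin 3)) R, (ρ ^ 2 • stPull (ρ ^ 2) ρ 0 x₀ p) σ z‖ₑ ^
        (3 / 2 : ℝ) ≤ ENNReal.ofReal (max C 0 * R ^ 2) := by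
    have hRT : (ρ * R) ^ 2 ≤ T := by nlinarith
    obtain ⟨-, -, hDD⟩ := hC T τ u p hfr hτ hrate x₀ (ρ * R) (by positivity) hRT
    -- the slices
    have hinner : ∀ σ : ℝ, ∫⁻ y in ball (0 : EuclideanSpace ℝ (Fin 3)) R,
        ‖(ρ ^ 2 • stPull (ρ ^ 2) ρ 0 x₀ p) σ y -
            ⨍ z in ball (0 : EuclideanSpace ℝ (Fin 3)) R, (ρ ^ 2 • stPull (ρ ^ 2) ρ 0 x₀ p) σ z‖ₑ ^
          (3 / 2 : ℝ) =
        ∫⁻ x in ball x₀ (ρ * R),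
          ‖p (ρ ^ 2 * σ) x - ⨍ z in ball x₀ (ρ * R), p (ρ ^ 2 * σ) z‖ₑ ^ (3 / 2 : ℝ) := by
      intro σ
      have e0 : x₀ + ρ • (0 : EuclideanSpace ℝ (Fin 3)) = x₀ := by simp
      have hz := setAverage_ball_zoom (p (0 + ρ ^ 2 * σ)) hρ x₀ 0 R
      rw [e0] at hz
      have hmean : ⨍ z in ball (0 : EuclideanSpace ℝ (Fin 3)) R, (ρ ^ 2 • stPull (ρ ^ 2) ρ 0 x₀ p) σ z =
          ρ ^ 2 * ⨍ z in ball x₀ (ρ * R), p (0 + ρ ^ 2 * σ) z := by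
        simp_rw [smul_stPull_apply, smul_eq_mul]
        rw [← hz]
        simp only [setAverage_eq, integral_const_mul, smul_eq_mul]
        ring
      have hpt : ∀ y, ‖(ρ ^ 2 • stPull (ρ ^ 2) ρ 0 x₀ p) σ y -
          ⨍ z in ball (0 : EuclideanSpace ℝ (Fin 3)) R, (ρ ^ 2 • stPull (ρ ^ 2) ρ 0 x₀ p) σ z‖ₑ ^
            (3 / 2 : ℝ) =
          ENNReal.ofReal (ρ ^ 3) *
            ‖p (ρ ^ 2 * σ) (x₀ + ρ • y) - ⨍ z in ball x₀ (ρ * R), p (ρ ^ 2 * σ) z‖ₑ ^ (3 / 2 : ℝ) := by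
        intro y
        rw [hmean, smul_stPull_apply, smul_eq_mul, zero_add, ← mul_sub, Real.enorm_eq_ofReal_abs,
          Real.enorm_eq_ofReal_abs, abs_mul, abs_of_pos hρ2,
          ENNReal.ofReal_rpow_of_nonneg (by positivity) (by norm_num),
          ENNReal.ofReal_rpow_of_nonneg (abs_nonneg _) (by norm_num),
          Real.mul_rpow hρ2.le (abs_nonneg _), ENNReal.ofReal_mul (by positivity)]
        congr 2
        rw [show (ρ ^ 2 : ℝ) = ρ ^ (2 : ℝ) by norm_cast, ← Real.rpow_mul hρ.le]
        norm_num
      simp_rw [hpt]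
      rw [lintegral_const_mul' _ _ ENNReal.ofReal_ne_top,
        setLIntegral_ball_comp_add_smul
          (fun x => ‖p (ρ ^ 2 * σ) x - ⨍ z in ball x₀ (ρ * R), p (ρ ^ 2 * σ) z‖ₑ ^ (3 / 2 : ℝ)) hρ x₀ R,
        ← mul_assoc, ← ENNReal.ofReal_mul (by positivity), mul_inv_cancel₀ (by positivity),
        ENNReal.ofReal_one, one_mul]
    simp_rw [hinner]
    -- the time substitution
    have hI : ∫⁻ σ in Icc (T / ρ ^ 2 - 1) (T / ρ ^ 2), ∫⁻ x in ball x₀ (ρ * R),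
          ‖p (ρ ^ 2 * σ) x - ⨍ z in ball x₀ (ρ * R), p (ρ ^ 2 * σ) z‖ₑ ^ (3 / 2 : ℝ) =
        ENNReal.ofReal (ρ ^ 2)⁻¹ * ∫⁻ t in Icc (ρ ^ 2 * (T / ρ ^ 2 - 1)) (ρ ^ 2 * (T / ρ ^ 2)),
          ∫⁻ x in ball x₀ (ρ * R), ‖p t x - ⨍ z in ball x₀ (ρ * R), p t z‖ₑ ^ (3 / 2 : ℝ) :=
      setLIntegral_Icc_comp_mul (fun t => ∫⁻ x in ball x₀ (ρ * R),
        ‖p t x - ⨍ z in ball x₀ (ρ * R), p t z‖ₑ ^ (3 / 2 : ℝ)) hρ2 _ _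
    have e1 : ρ ^ 2 * (T / ρ ^ 2 - 1) = T - ρ ^ 2 := by field_simp
    have e2 : ρ ^ 2 * (T / ρ ^ 2) = T := by field_simp
    rw [hI, e1, e2]
    have hsubI : Icc (T - ρ ^ 2) T ⊆ Icc (T - (ρ * R) ^ 2) T := by
      have hR2 : 1 ≤ R ^ 2 := by nlinarith
      have : ρ ^ 2 ≤ (ρ * R) ^ 2 := by rw [mul_pow]; nlinarith
      exact Icc_subset_Icc (by linarith) le_rfl
    have hDD' : ∫⁻ t in Icc (T - (ρ * R) ^ 2) T, ∫⁻ x in ball x₀ (ρ * R),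
        ‖p t x - ⨍ z in ball x₀ (ρ * R), p t z‖ₑ ^ (3 / 2 : ℝ) ≤ ENNReal.ofReal (C * (ρ * R) ^ 2) := by
      refine le_trans (le_of_eq (lintegral_congr fun t => lintegral_congr fun x => ?_)) hDD
      rw [← ENNReal.ofReal_rpow_of_nonneg (abs_nonneg _) (by norm_num), ← Real.enorm_eq_ofReal_abs]
    calc ENNReal.ofReal (ρ ^ 2)⁻¹ * ∫⁻ t in Icc (T - ρ ^ 2) T, ∫⁻ x in ball x₀ (ρ * R),
          ‖p t x - ⨍ z in ball x₀ (ρ * R), p t z‖ₑ ^ (3 / 2 : ℝ)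
        ≤ ENNReal.ofReal (ρ ^ 2)⁻¹ * ENNReal.ofReal (C * (ρ * R) ^ 2) :=
          mul_le_mul' le_rfl ((lintegral_mono_set hsubI).trans hDD')
      _ = ENNReal.ofReal (C * R ^ 2) := by
          rw [← ENNReal.ofReal_mul (by positivity)]
          congr 1
          field_simp
      _ ≤ ENNReal.ofReal (max C 0 * R ^ 2) := ENNReal.ofReal_le_ofReal (by nlinarith)
  have key := abs_pairing_sub_le_of_classical hcl' hT' hθ hθR hC₁ hC₂ hC₃ (by positivity)
    (by positivity) hE hD ht
  rwa [show T / ρ ^ 2 - (T / ρ ^ 2 + s) = -s by ring] at key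

/-- **Clause (5) of `ThinObject` for the zoom limit of cheap cascades.**  In the setting of
`exists_typeIAncientMild_zoomLimit_of_cheapCascades` (zooms along `φ` converging pointwise on the
open past to `W`) let `g` be a weak limit of the final slices of the zooms against `L²` fields
vanishing off balls (the trace of `exists_traceLimit_of_cheapCascades`).  Then for every smooth
compactly supported `θ`, `∫⟪W(t), θ⟫ → ∫⟪g, θ⟫` as `t ↑ 0`: the time modulus
`abs_pairing_zoom_sub_le` is uniform along the sequence, the pairings at `s < 0` pass to the limit by
dominated convergence (Type-I bound `|v(s)| ≤ M/√(-s)`), those at `s = 0` by weak convergence.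
[folklore] -/
theorem tendsto_pairing_zoomLimit_of_cheapCascades {M q : ℝ} {T τ ρ : ℕ → ℝ}
    {x₀ : ℕ → EuclideanSpace ℝ (Fin 3)}
    {u : ℕ → ℝ → EuclideanSpace ℝ (Fin 3) → EuclideanSpace ℝ (Fin 3)}
    {p : ℕ → ℝ → EuclideanSpace ℝ (Fin 3) → ℝ}
    (hdata : ∀ K : ℕ, TaoFrame (T K) (u K) (p K) ∧ 0 < τ K ∧ 0 < ρ K ∧
        Real.exp (2 * K) * ρ K ^ 2 ≤ T K ∧
        τ K ≤ M ^ 2 * Real.exp (-2 * (K : ℝ)) * ρ K ^ 2 ∧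
        (∀ t ∈ Icc 0 (T K), ∀ x : EuclideanSpace ℝ (Fin 3),
          ‖u K t x‖ ≤ M * (T K + τ K - t) ^ (-(1 / 2 : ℝ))) ∧
        Real.exp K ≤ ρ K * ‖u K (T K) (x₀ K)‖ ∧
        ∀ j : ℕ, 1 ≤ j → j ≤ K →
          ∫⁻ x in {x : EuclideanSpace ℝ (Fin 3) | ρ K < ‖x - x₀ K‖ ∧ ‖x - x₀ K‖ < Real.exp j * ρ K},
              ENNReal.ofReal (‖u K (T K) x‖ ^ 3) ≤ ENNReal.ofReal (q * j))
    {φ : ℕ → ℕ} (hφ : StrictMono φ) {W : ℝ → EuclideanSpace ℝ (Fin 3) → EuclideanSpace ℝ (Fin 3)}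
    (hpt : ∀ t < 0, ∀ x, Tendsto
      (fun j => ((ρ (φ j)) • stPull (ρ (φ j) ^ 2) (ρ (φ j)) (T (φ j)) (x₀ (φ j)) (u (φ j))) t x)
      atTop (𝓝 (W t x)))
    {g : EuclideanSpace ℝ (Fin 3) → EuclideanSpace ℝ (Fin 3)}
    (hg : ∀ (ζ : EuclideanSpace ℝ (Fin 3) → EuclideanSpace ℝ (Fin 3)), MemLp ζ 2 volume → ∀ (a : ℝ),
        (∀ y, y ∉ ball (0 : EuclideanSpace ℝ (Fin 3)) a → ζ y = 0) →
        Tendsto (fun k => ∫ y, ⟪((ρ (φ k)) • stPull (ρ (φ k) ^ 2) (ρ (φ k)) (T (φ k))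
          (x₀ (φ k)) (u (φ k))) 0 y, ζ y⟫) atTop (𝓝 (∫ y, ⟪g y, ζ y⟫))) :
    ∀ θ : EuclideanSpace ℝ (Fin 3) → EuclideanSpace ℝ (Fin 3), ContDiff ℝ (⊤ : ℕ∞) θ →
      HasCompactSupport θ →
      Tendsto (fun t => ∫ x, inner ℝ (W t x) (θ x)) (nhdsWithin 0 (Iio 0))
        (nhds (∫ x, inner ℝ (g x) (θ x))) := by
  intro θ hθ hθc
  set v : ℕ → ℝ → EuclideanSpace ℝ (Fin 3) → EuclideanSpace ℝ (Fin 3) :=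
    fun j => (ρ (φ j)) • stPull (ρ (φ j) ^ 2) (ρ (φ j)) (T (φ j)) (x₀ (φ j)) (u (φ j)) with hv
  obtain ⟨C, hC⟩ := stub_uniformScaledEnergy M
  -- a support radius `R ≥ 1`
  obtain ⟨R₀, hR₀⟩ : ∃ R₀ : ℝ, tsupport θ ⊆ closedBall (0 : EuclideanSpace ℝ (Fin 3)) R₀ :=
    hθc.isCompact.isBounded.subset_closedBall 0
  obtain ⟨R, hRdef⟩ : ∃ R : ℝ, R = max R₀ 0 + 1 := ⟨_, rfl⟩
  have hR : 1 ≤ R := by rw [hRdef]; linarith [le_max_right R₀ 0]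
  have hθR : ∀ y, y ∉ ball (0 : EuclideanSpace ℝ (Fin 3)) R → θ y = 0 := by
    intro y hy
    refine image_eq_zero_of_notMem_tsupport fun h => hy ?_
    have h' := hR₀ h
    rw [mem_closedBall, dist_zero_right] at h'
    rw [mem_ball, dist_zero_right, hRdef]
    linarith [le_max_left R₀ 0]
  -- derivative bounds of `θ`
  have hθ2 : ContDiff ℝ 2 θ := contDiff_infty.1 hθ 2
  obtain ⟨C₁, hC₁⟩ := (hθ2.continuous_fderiv (by norm_num)).bounded_above_of_compact_support
    (hθc.fderiv (𝕜 := ℝ))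
  obtain ⟨C₂, hC₂⟩ := (continuous_laplacian hθ2).bounded_above_of_compact_support
    (hasCompactSupport_laplacian hθc)
  have hts := tsupport_subset_closedBall_of_ball hθR
  obtain ⟨C₃, hC₃⟩ := (continuous_divergence (hθ2.continuous_fderiv (by norm_num))
    ).bounded_above_of_compact_support (HasCompactSupport.intro
      (isCompact_closedBall (0 : EuclideanSpace ℝ (Fin 3)) R)
      (fun y hy => divergence_eq_zero_of_notMem_tsupport fun h => hy (hts h)))
  obtain ⟨Kmod, hKmod⟩ : ∃ Kmod : ℝ, Kmod =
      C₁ * (max C 0 * R) + C₂ * ((volume (ball (0 : EuclideanSpace ℝ (Fin 3)) R)).toReal + max C 0 * R) +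
        C₃ * (max C 0 * R ^ 2 + (volume (ball (0 : EuclideanSpace ℝ (Fin 3)) R)).toReal) := ⟨_, rfl⟩
  -- a cascade length beyond which `e^{2K} ≥ R² + 1`
  obtain ⟨K₀, hK₀⟩ : ∃ K₀ : ℕ, R ^ 2 + 1 ≤ Real.exp (2 * (K₀ : ℝ)) := by
    refine ⟨⌈R ^ 2⌉₊, ?_⟩
    have h1 := Nat.le_ceil (R ^ 2)
    have h2 := Real.add_one_le_exp (2 * (⌈R ^ 2⌉₊ : ℝ))
    nlinarith
  -- Step A: the time modulus, uniformly along the sequence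
  have hA : ∀ᶠ k in atTop, ∀ s ∈ Ioo (-1 : ℝ) 0,
      |(∫ y, ⟪v k 0 y, θ y⟫) - ∫ y, ⟪v k s y, θ y⟫| ≤ Kmod * Real.sqrt (Real.sqrt (-s)) := by
    filter_upwards [eventually_ge_atTop K₀] with k hk s hs
    have hKk : R ^ 2 + 1 ≤ Real.exp (2 * (φ k : ℕ)) := by
      refine hK₀.trans (Real.exp_le_exp.2 ?_)
      have : (K₀ : ℝ) ≤ φ k := by exact_mod_cast hk.trans (hφ.id_le k)
      linarith
    rw [hKmod]
    exact abs_pairing_zoom_sub_le (x₀ (φ k)) hC (hdata (φ k)).1 (hdata (φ k)).2.1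
      (hdata (φ k)).2.2.1 (hdata (φ k)).2.2.2.1 (hdata (φ k)).2.2.2.2.2.1 hθ2 hR hθR hC₁ hC₂ hC₃
      hKk hs
  -- Step B: the final slices converge weakly
  have hB : Tendsto (fun k => ∫ y, ⟪v k 0 y, θ y⟫) atTop (𝓝 (∫ y, ⟪g y, θ y⟫)) :=
    hg θ (hθ.continuous.memLp_of_hasCompactSupport hθc) R hθR
  -- Step C: the slices at `s < 0` converge by dominated convergence
  obtain ⟨Cθ, hCθ⟩ := hθ.continuous.bounded_above_of_compact_support hθc
  have hCstep : ∀ s ∈ Ioo (-1 : ℝ) 0,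
      Tendsto (fun k => ∫ y, ⟪v k s y, θ y⟫) atTop (𝓝 (∫ y, ⟪W s y, θ y⟫)) := by
    intro s hs
    have hsqrt : 0 < Real.sqrt (-s) := Real.sqrt_pos.2 (by linarith [hs.2])
    have hsI : ∀ k, s ∈ Ioo (-Real.exp (2 * (φ k : ℕ))) 0 := fun k =>
      ⟨by linarith [hs.1, Real.one_le_exp (by positivity : (0 : ℝ) ≤ 2 * (φ k : ℕ))], hs.2⟩
    refine tendsto_integral_of_dominated_convergence (fun y => M / Real.sqrt (-s) * ‖θ y‖)
      (fun k => ?_) ?_ (fun k => Eventually.of_forall fun y => ?_)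
      (Eventually.of_forall fun y => (hpt s hs.2 y).inner tendsto_const_nhds)
    · have hz := zoom_of_cheapCascade (x₀ (φ k)) (hdata (φ k)).1 (hdata (φ k)).2.1
        (hdata (φ k)).2.2.1 (hdata (φ k)).2.2.2.1 (hdata (φ k)).2.2.2.2.2.1
      have hcont : Continuous (v k s) :=
        hz.1.comp_continuous (continuous_const.prodMk continuous_id) fun y => ⟨hsI k, mem_univ _⟩
      exact (hcont.inner hθ.continuous).aestronglyMeasurable
    · exact (continuous_const.mul hθ.continuous.norm).integrable_of_hasCompactSupport
        hθc.norm.mul_left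
    · have hz := (zoom_of_cheapCascade (x₀ (φ k)) (hdata (φ k)).1 (hdata (φ k)).2.1
        (hdata (φ k)).2.2.1 (hdata (φ k)).2.2.2.1 (hdata (φ k)).2.2.2.2.2.1).2.2.2 s (hsI k) y
      have hvb : ‖v k s y‖ ≤ M / Real.sqrt (-s) := by
        rw [le_div_iff₀ hsqrt, mul_comm]; exact hz
      calc ‖⟪v k s y, θ y⟫‖ ≤ ‖v k s y‖ * ‖θ y‖ :=
            (Real.norm_eq_abs _).trans_le (abs_real_inner_le_norm _ _)
        _ ≤ M / Real.sqrt (-s) * ‖θ y‖ := by gcongr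
  -- Step D: the modulus passes to the limit
  have hD : ∀ s ∈ Ioo (-1 : ℝ) 0,
      |(∫ y, ⟪g y, θ y⟫) - ∫ y, ⟪W s y, θ y⟫| ≤ Kmod * Real.sqrt (Real.sqrt (-s)) := by
    intro s hs
    have hlim : Tendsto (fun k => |(∫ y, ⟪v k 0 y, θ y⟫) - ∫ y, ⟪v k s y, θ y⟫|) atTop
        (𝓝 |(∫ y, ⟪g y, θ y⟫) - ∫ y, ⟪W s y, θ y⟫|) := (hB.sub (hCstep s hs)).abs
    exact le_of_tendsto hlim (hA.mono fun k hk => hk s hs)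
  -- Step E: conclusion
  have hmod : Tendsto (fun s : ℝ => Kmod * Real.sqrt (Real.sqrt (-s))) (𝓝[<] 0) (𝓝 0) := by
    have hc : Continuous fun s : ℝ => Kmod * Real.sqrt (Real.sqrt (-s)) :=
      continuous_const.mul (continuous_neg.sqrt.sqrt)
    have := hc.tendsto 0
    rw [neg_zero, Real.sqrt_zero, Real.sqrt_zero, mul_zero] at this
    exact this.mono_left nhdsWithin_le_nhds
  have hev : ∀ᶠ t in 𝓝[<] (0 : ℝ), ‖(∫ x, ⟪W t x, θ x⟫) - ∫ x, ⟪g x, θ x⟫‖ ≤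
      Kmod * Real.sqrt (Real.sqrt (-t)) := by
    filter_upwards [Ioo_mem_nhdsLT (show (-1 : ℝ) < 0 by norm_num)] with t ht
    rw [Real.norm_eq_abs, abs_sub_comm]
    exact hD t ht
  exact tendsto_sub_nhds_zero_iff.1 (squeeze_zero_norm' hev hmod)

end Summit.NavierStokesRegularity.NavierStokesRegularity.Theorems.ThinCascade

end
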